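import Literature.MathematicalPhysics.QuantumFieldTheory.Balaban1983to89.B11Eq98W80ModulusV0Discharged

/-!
# `Balaban1983to89.B11Eq98W80ModulusAtFlat` — T. Bałaban, *The variational problem and background fields in renormalization group method for lattice gauge theories*, Commun. Math. Phys. **102** (1985) 277–309 [Balaban1985Variational]: Prop. 4 (97)–(98) pp. 292–293, Sect. C (44)–(52) p. 285, Prop. 6 (117)–(121) p. 295, (90)/(92) pp. 291–292, (115) p. 294, with [Balaban1985BackgroundPropagators] (3.1)–(3.5) pp. 390–391, Thm 3.4 p. 400 — THE BACKGROUND MODULUS OF `W = (δ/δA′)V` AT THE FLAT POINT MODULO THE LETTER DEFECTS `δ_H`, `δ_C` ONLY: the V₀-group's `δ_V` discharged (`‖U(b) − 1‖ ≤ ε`) and the `Δ_π` letter transported (`Δ_π,1 := Δ_π ∘ ι⁻¹`, `δ_Δ = 0`)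

statement-level skeleton of published theorems with citation tags; proofs where landed; nothing here is a claim about the Yang–Mills mass gap

CITATION HEADER (lean-in-tree rule 2026-08-18).  WHAT IS REPRODUCED: nothing of print is asserted.  Junction of this lineage's
`B11Eq98W80ModulusV0Discharged.exists_W80_background_modulus_HCDelta` (W80's background modulus across two carriers modulo `δ_H, δ_C, δ_Δ`) with two
letter choices that the consumer at the FLAT point (`Support/NE9CurChartLipschitzAtFlat`, the OFFER O-ne9p1-g83-3 composition `…AtFlatW80`) makes anyway:
the second background IS `1` (so the bond modulus is `‖U(b) − 1‖ ≤ ε`, the flat bond variables are in the unit balls by `‖1‖ = 1`), and the second `Δ_π` letter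
IS the first one transported along the jet identity, `Δ_π ∘L ι⁻¹` (so `δ_Δ = 0` by `ι⁻¹ ∘ ι = id`, `B11Eq80CurrentTwoCarriers.jetId_symm_apply`; its norm is
`≤ ‖Δ_π‖·K_ι`, absorbed by running the junction at the bound `M_Δ·K_ι`).

WHAT IS PROVED (sorry-free; axioms standard; 0 def).  **`exists_W80_background_modulus_at_flat`** — for the scalar letters of
`exists_W80_background_modulus_HCDelta` (and `K_ι ≥ 1`, `R_V ≤ 1/16`, the level-geometry display `Λ`, the top level `j_M`): `∃ K > 0` such that under the two radius
caps, for two derivative letters `Dc₁, Dc₂` (`‖Dc₂ g‖ ≤ M_D‖g‖`, `‖ι‖, ‖ι⁻¹‖ ≤ K_ι` pointwise), two Sect. C regimes, `ρ, τ` bounded by `M_ρ, M_τ`, a unit-ball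
background `U` with `‖U(b) − 1‖ ≤ ε` (`0 ≤ ε`), the V₀-slots at `U` (carrier `Dc₁`) and at `1` (carrier `Dc₂`), letters `J`, `Δ_π` (`‖J‖ ≤ M_J`, `‖Δ_π‖ ≤ M_Δ`), the
room scalars `ρ_C, s_C`, and the letter defects `δ_H, δ_C`:
`∀ P, ‖P‖ < r → ‖W80 ρ τ U H₁ C₁ ε_C J Δ_π P − W80 ρ τ 1 H₂ C₂′ ε_C J (Δ_π ∘L ι⁻¹) (ιP)‖₍₋₃₎ ≤ K·(δ_T(δ_H, δ_C) + δ_Q(δ_H, δ_C) + (524288·e⁴(d − 1)Λ²L^{j_M}M_ρM_τR_V²)·ε)`.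

HONEST SCOPE.  (i) `δ_H, δ_C` stay displayed (PRODUCED by the OWNER lineage's `B11Eq117LetterDefects.exists_letter_defects_at_flat` ∕
`B11Eq44COperatorModulus.exists_Cc_modulus_at_flat` at the chain's letters — not re-derived here).  (ii) CRUDE fixed-lattice constant in the `ε` term
(`∝ L^{j_M}`; (38) unused, (39) not summed by parts).  (iii) Nothing of Prop. 4, (98), Prop. 6, Thm 3.4 proved; NOT the Support-side (Z)+W80 composition; NOT
summit progress (cell pub-balaban: NE9 NOT PRINTED / NOT PROVED; «NE9 ⇐ the named binders»; spine PROVED 0/9; HONEST DEPENDENCY: continuum YM on T⁴ ⇐ BetaPertH ∧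
nine spine estimates (0/9 proved); BetaPertH ⇐ (D1) ∧ (D4) ∧ CAP+tail; G-an2-4 gates asym, D1 and NE2/3/4).  Unit `b2b-balaban-t4-ne9-formalise-leaf-05` (NE9 crux-team
leaf prover, gen 71).  Imports `B11Eq98W80ModulusV0Discharged` ONLY; modifies nothing.
-/

noncomputable section

open Metric Set

namespace Literature.MathematicalPhysics.QuantumFieldTheory.Balaban1983to89.B11Eq98W80ModulusAtFlat

open Literature.MathematicalPhysics.QuantumFieldTheory.Balaban1983to89.B11Prop6Scheme (Prop4Hyp)
open Literature.MathematicalPhysics.QuantumFieldTheory.Balaban1983to89.B11Eq174Chart (Regime)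
open Literature.MathematicalPhysics.QuantumFieldTheory.Balaban1983to89.B11Eq63V0GroupCurrent (curV0)
open Literature.MathematicalPhysics.QuantumFieldTheory.Balaban1983to89.B11Eq80Current (W80)
open Literature.MathematicalPhysics.QuantumFieldTheory.Balaban1983to89.B11Eq111FrakG (jetLinearEquiv)
open Literature.MathematicalPhysics.QuantumFieldTheory.Balaban1983to89.B9Eq39Adjoint (posPlaq)
open Literature.MathematicalPhysics.QuantumFieldTheory.Balaban1983to89.B11Eq90StB (st)
open Literature.MathematicalPhysics.QuantumFieldTheory.Balaban1983to89.B11Eq90V0primeBond (plaqWeight)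
open Literature.MathematicalPhysics.QuantumFieldTheory.Balaban1983to89.B11Eq90V0primeCurrent (Tsh)
open Literature.MathematicalPhysics.QuantumFieldTheory.Balaban1983to89.B11Eq80CurrentTwoCarriers (jetId_symm_apply)
open Literature.MathematicalPhysics.QuantumFieldTheory.Balaban1983to89.B11Eq98W80ModulusV0Discharged (exists_W80_background_modulus_HCDelta)
open B9SectCLatticeCarrier (Bond)
open B4Sect5Torus (TSite)
open B11Eq115Space

variable {𝔸 : Type*} [NormedRing 𝔸] [NormedAlgebra ℂ 𝔸] [FiniteDimensional ℂ 𝔸] [NormOneClass 𝔸]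
variable {d : ℕ} {Pd : Fin d → ℕ} {L η : ℝ} [Fact (0 < L)] [Fact (0 < η)] {lev₀ : Bond d Pd → ℕ} {κ' : Type*} [Fintype κ']
  {lev₁ : κ' → ℕ}
variable {𝒳 : Type*} [NormedAddCommGroup 𝒳] [NormedSpace ℂ 𝒳]

/-- **THE W80 BACKGROUND MODULUS AT THE FLAT POINT, MODULO `δ_H, δ_C` ONLY** — see the module header.  `K` is chosen BEFORE the carriers and all operator
letters (it is `exists_W80_background_modulus_HCDelta`'s at the bound `M_Δ·K_ι` for the `Δ_π` letters). [folklore]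
[cite: Balaban1985Variational, Prop. 4 (97)–(98) pp.292–293, (90) p.291, (115) p.294, (47)–(52) p.285, Prop. 6 (117)–(121) p.295; Balaban1985BackgroundPropagators, (3.1)–(3.5) pp.390–391, Thm 3.4 p.400] -/
theorem exists_W80_background_modulus_at_flat [CompleteSpace 𝒳] [CompleteSpace 𝔸] {b C₂ c₄ aC εC CV RV Mρ Mτ MJ MΔ MD Kι Λ : ℝ} {jM : ℕ}
    (haC : 0 < aC) (hεC : 0 ≤ εC) (hcontr : 4 * b * C₂ * (εC + aC) < 1) (hCV : 0 ≤ CV) (hRV : 0 < RV) (hRV' : RV ≤ 1 / 16)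
    (hMρ : 0 ≤ Mρ) (hMτ : 0 ≤ Mτ) (hMJ : 0 ≤ MJ) (hMΔ : 0 ≤ MΔ) (hMD : 0 ≤ MD) (hKι : 1 ≤ Kι) (hL : 1 ≤ L)
    (hΛ : ∀ q ∈ posPlaq (TSite d Pd) (Fin d), ∀ (μ₀ : Fin d) (x₀ : TSite d Pd), q ∈ st Tsh μ₀ x₀ →
      levWeight L η lev₀ 1 (x₀, μ₀) ≤ Λ * plaqWeight Tsh (levWeight L η lev₀ 1) q)
    (hlev : ∀ b, lev₀ b ≤ jM) :
    ∃ K : ℝ, 0 < K ∧ ∀ {r : ℝ}, r ≤ aC / (2 * Kι ^ 2) → r ≤ RV / (4 * Kι * (1 / (1 - 4 * b * C₂ * (εC + aC)))) →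
      ∀ {Dc₁ Dc₂ : (Bond d Pd → 𝔸) →ₗ[ℂ] (κ' → 𝔸)}, (∀ g : Bond d Pd → 𝔸, ‖Dc₂ g‖ ≤ MD * ‖g‖) →
      (∀ P : Space115 L η lev₀ lev₁ Dc₁, ‖(LinearMap.toContinuousLinearMap ((jetLinearEquiv L η lev₀ lev₁ Dc₂).symm.toLinearMap ∘ₗ (jetLinearEquiv L η lev₀ lev₁ Dc₁).toLinearMap)) P‖ ≤ Kι * ‖P‖) → (∀ Q : Space115 L η lev₀ lev₁ Dc₂, ‖(LinearMap.toContinuousLinearMap ((jetLinearEquiv L η lev₀ lev₁ Dc₁).symm.toLinearMap ∘ₗ (jetLinearEquiv L η lev₀ lev₁ Dc₂).toLinearMap)) Q‖ ≤ Kι * ‖Q‖) →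
      ∀ {H₁ : 𝒳 →L[ℂ] Space115 L η lev₀ lev₁ Dc₁} {C₁ : Space115 L η lev₀ lev₁ Dc₁ → 𝒳}
        {H₂ : 𝒳 →L[ℂ] Space115 L η lev₀ lev₁ Dc₂} {C₂' : Space115 L η lev₀ lev₁ Dc₂ → 𝒳},
        Regime H₁ 0 C₁ b 0 C₂ c₄ 0 aC εC → Prop4Hyp C₁ C₂ c₄ → Regime H₂ 0 C₂' b 0 C₂ c₄ 0 aC εC → Prop4Hyp C₂' C₂ c₄ →
      ∀ (ρ : (𝔸 →L[ℂ] ℂ) →L[ℂ] 𝔸) (τ : 𝔸 →L[ℂ] ℂ) (U : Bond d Pd → 𝔸ˣ), ‖ρ‖ ≤ Mρ → ‖τ‖ ≤ Mτ →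
        (∀ b, ‖(U b : 𝔸)‖ ≤ 1 ∧ ‖(((U b)⁻¹ : 𝔸ˣ) : 𝔸)‖ ≤ 1) →
      ∀ {ε : ℝ}, 0 ≤ ε → (∀ b, ‖(U b : 𝔸) - 1‖ ≤ ε) →
        (∀ Y : Space115 L η lev₀ lev₁ Dc₁, ‖Y‖ < RV → ‖curV0 (lev₁ := lev₁) (Dc := Dc₁) ρ τ U Y‖ ≤ CV * ‖Y‖ ^ 2) →
        (∀ Y : Space115 L η lev₀ lev₁ Dc₂, ‖Y‖ < RV →
          ‖curV0 (lev₁ := lev₁) (Dc := Dc₂) ρ τ (fun _ : Bond d Pd => (1 : 𝔸ˣ)) Y‖ ≤ CV * ‖Y‖ ^ 2) →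
      ∀ (J : NegSize L η lev₀ 3 𝔸) (Δπ : Space115 L η lev₀ lev₁ Dc₁ →L[ℂ] NegSize L η lev₀ 3 𝔸), ‖J‖ ≤ MJ → ‖Δπ‖ ≤ MΔ →
      ∀ {ρC sC : ℝ}, Kι * (εC + aC) ≤ ρC → 0 < sC → 2 * (ρC + sC) ≤ c₄ → 4 * b * C₂ * (ρC + sC) < 1 →
      ∀ {δH δC : ℝ}, 0 ≤ δH → 0 ≤ δC →
        (∀ B : 𝒳, ‖(LinearMap.toContinuousLinearMap ((jetLinearEquiv L η lev₀ lev₁ Dc₂).symm.toLinearMap ∘ₗ (jetLinearEquiv L η lev₀ lev₁ Dc₁).toLinearMap)) (H₁ B) - H₂ B‖ ≤ δH * ‖B‖) →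
        (∀ y : Space115 L η lev₀ lev₁ Dc₁, ‖y‖ < εC + aC → ‖C₁ y - C₂' ((LinearMap.toContinuousLinearMap ((jetLinearEquiv L η lev₀ lev₁ Dc₂).symm.toLinearMap ∘ₗ (jetLinearEquiv L η lev₀ lev₁ Dc₁).toLinearMap)) y)‖ ≤ δC) →
      ∀ P : Space115 L η lev₀ lev₁ Dc₁, ‖P‖ < r →
        ‖W80 ρ τ U H₁ C₁ εC J Δπ P - W80 ρ τ (fun _ : Bond d Pd => (1 : 𝔸ˣ)) H₂ C₂' εC J
            (Δπ.comp (LinearMap.toContinuousLinearMap ((jetLinearEquiv L η lev₀ lev₁ Dc₁).symm.toLinearMap ∘ₗ (jetLinearEquiv L η lev₀ lev₁ Dc₂).toLinearMap)))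
            ((LinearMap.toContinuousLinearMap ((jetLinearEquiv L η lev₀ lev₁ Dc₂).symm.toLinearMap ∘ₗ (jetLinearEquiv L η lev₀ lev₁ Dc₁).toLinearMap)) P)‖ ≤
          K * ((δH * (C₂ * (εC + aC) ^ 2) + b * δC) / (1 - 4 * b * C₂ * (ρC + sC)) +
            (8 * C₂ * δH + 8 * b * δC / (εC + aC) ^ 2) * aC ^ 2
            + (524288 * Real.exp 4 * ((d - 1 : ℕ) : ℝ) * Λ ^ 2 * L ^ jM * Mρ * Mτ * RV ^ 2) * ε) := by
  have hKι0 : 0 < Kι := lt_of_lt_of_le one_pos hKι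
  have hMΔ' : 0 ≤ MΔ * Kι := mul_nonneg hMΔ hKι0.le
  -- the junction run at the `Δ_π` bound `M_Δ·K_ι`
  obtain ⟨K, hK, HW⟩ := exists_W80_background_modulus_HCDelta (d := d) (Pd := Pd) (L := L) (η := η) (lev₀ := lev₀) (κ' := κ') (lev₁ := lev₁)
    (𝒳 := 𝒳) (𝔸 := 𝔸) haC hεC hcontr hCV hRV hRV' hMρ hMτ hMJ hMΔ' hMD hKι hL hΛ hlev
  refine ⟨K, hK, ?_⟩
  intro r hra hrV Dc₁ Dc₂ hD₂ hι hκι H₁ C₁ H₂ C₂' RC₁ hC₁ RC₂ hC₂ ρ τ U hρ hτ hUn ε hε hUε hqV₁ hqV₂ J Δπ hJ hΔ ρC sC hρ₁ hsC hdomC hκC δH δC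
    hδH hδC hdH hdC P hP
  -- the flat background's bond variables are in the unit balls, within `ε` of `U`'s
  have hUn₂ : ∀ b : Bond d Pd, ‖(((fun _ : Bond d Pd => (1 : 𝔸ˣ)) b : 𝔸ˣ) : 𝔸)‖ ≤ 1 ∧
      ‖((((fun _ : Bond d Pd => (1 : 𝔸ˣ)) b)⁻¹ : 𝔸ˣ) : 𝔸)‖ ≤ 1 := fun _ => ⟨by simp, by simp⟩
  have hδ : ∀ b : Bond d Pd, ‖(U b : 𝔸) - (((fun _ : Bond d Pd => (1 : 𝔸ˣ)) b : 𝔸ˣ) : 𝔸)‖ ≤ ε := fun b => by simpa using hUε b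
  -- the transported `Δ_π` letter: norm `≤ M_Δ·K_ι`, defect `0`
  have hΔ₁ : ‖Δπ‖ ≤ MΔ * Kι := hΔ.trans (le_mul_of_one_le_right hMΔ hKι)
  have hΔ₂ : ‖Δπ.comp (LinearMap.toContinuousLinearMap ((jetLinearEquiv L η lev₀ lev₁ Dc₁).symm.toLinearMap ∘ₗ (jetLinearEquiv L η lev₀ lev₁ Dc₂).toLinearMap))‖ ≤ MΔ * Kι := by
    refine (ContinuousLinearMap.opNorm_comp_le _ _).trans (mul_le_mul hΔ ?_ (norm_nonneg _) hMΔ)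
    exact ContinuousLinearMap.opNorm_le_bound _ hKι0.le hκι
  have hmΔ : ∀ Y : Space115 L η lev₀ lev₁ Dc₁,
      ‖Δπ Y - (Δπ.comp (LinearMap.toContinuousLinearMap ((jetLinearEquiv L η lev₀ lev₁ Dc₁).symm.toLinearMap ∘ₗ (jetLinearEquiv L η lev₀ lev₁ Dc₂).toLinearMap)))
        ((LinearMap.toContinuousLinearMap ((jetLinearEquiv L η lev₀ lev₁ Dc₂).symm.toLinearMap ∘ₗ (jetLinearEquiv L η lev₀ lev₁ Dc₁).toLinearMap)) Y)‖ ≤ 0 * ‖Y‖ := fun Y => by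
    rw [ContinuousLinearMap.comp_apply, jetId_symm_apply, sub_self, norm_zero, zero_mul]
  have h := HW hra hrV hD₂ hι hκι RC₁ hC₁ RC₂ hC₂ ρ τ U (fun _ => 1) hρ hτ hUn hUn₂ hε hδ hqV₁ hqV₂ J Δπ _ hJ hΔ₁ hΔ₂ hρ₁ hsC hdomC hκC hδH hδC le_rfl hdH hdC
    hmΔ P hP
  simpa only [add_zero] using h

end Literature.MathematicalPhysics.QuantumFieldTheory.Balaban1983to89.B11Eq98W80ModulusAtFlat

end
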